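import Literature.NumberTheory.Automorphic.AutomorphicQuotientDiagonalTrace
import Literature.NumberTheory.Automorphic.AutomorphicL2Separable
import Literature.NumberTheory.Automorphic.HilbertRepHilbertSchmidtBlocks
import Literature.NumberTheory.Automorphic.CompactQuotientFiniteMultiplicity
import HarnessLib

/-!
# The spectral expansion of the diagonal trace: `θ(f ⋆ f^*) = Σ_π m(π) ‖π(f)‖²_{HS}`
(Gelbart, *Automorphic forms on adele groups* (1975), (10.12)–(10.14): "`tr R'_ψ(f ⋆ f^*) = Σ m(π) tr π(f) π(f)^*`";
Gelfand–Graev–Piatetski-Shapiro (1969), Ch. 1 §2; Deitmar–Echterhoff (2014), Thm. 9.2.2; Rogawski (1990), §14.4–14.5: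
"`T_{G′}(f′)` is the trace of `ρ(f′)` on `L(G′)` … `= Σ_{π′} m(π′) tr π′(f′)`")

Topic `NumberTheory/Automorphic`; namespace `Literature.NumberTheory.Automorphic` (dot notation on `AdelicGroupData`, grouping
sub-namespace `UnitaryGroup`). THEOREMS ONLY — no definition, no named fact, no `sorry`, no instance or instance attribute.
ASSEMBLY of the tree's pieces at the level of an adelic group datum `𝒢` with COMPACT automorphic quotient
`X = G(𝔸_K) ⧸ (A_G · G(K))` and an automorphic measure `μ`:

* `AdelicGroupData.exists_orthogonalDecomposition_rightRegular` — **`L²(X, μ) = ⊕̂_{W ∈ S} W`**: there is a COUNTABLE set `S` of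
  pairwise orthogonal, topologically irreducible closed invariant subspaces of the regular representation with dense sum, and every
  member occurs with FINITE multiplicity (`multiplicity W = #{W′ ∈ S | W′ ≃ W} < ∞`, `IsUnitary.multiplicity_eq_card_of_set`) —
  Gelfand–Graev–Piatetski-Shapiro / Deitmar–Echterhoff Thm. 9.2.2 (tree: `isDiscretelyDecomposable_rightRegular_of_locallyCompactSpace`,
  `IsUnitary.exists_orthogonalDecomposition_of_isDiscretelyDecomposable`, `Set.Pairwise.countable_of_isOrtho` with
  `secondCountableTopology_L2`, `multiplicity_lt_top_of_compactSpace`);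
* `AdelicGroupData.ofReal_diagTrace_re_eq_tsum_enorm_sq`, `…ofReal_diagTrace_re_eq_tsum_blocks` — for the NAMED trace functional
  `θ = 𝒢.diagTrace μ ρ ν` (`AutomorphicQuotientDiagonalTrace`) and `F = f ⋆ f^*`: **`θ(F) = Σ_{W ∈ S} ‖R(f)|_W‖²_{HS}`** in `[0, ∞]`,
  for EVERY orthogonal decomposition `S` and every choice of Hilbert bases of the members (`diagTrace_hasSum_norm_sq` +
  `ClosedSubrep.tsum_enorm_sq_apply_eq_tsum_set`); `…tsum_block_le_ofReal_diagTrace_re` — each block is `≤ θ(F) < ∞`;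
  `…diagTrace_re_eq_toReal_tsum_blocks` — the real form;
* `AdelicGroupData.ofReal_diagTrace_re_eq_tsum_multiplicity_mul` — **the multiplicity form `θ(f ⋆ f^*) = Σ_{[π]} m(π) ‖π(f)‖²_{HS}`**:
  for every map `q` on `S` classifying unitary equivalence and every choice of representatives `rep` of its classes,
  `θ(F) = Σ_{c} m(rep c) · Σ_k ‖R(f) e^{rep c}_k‖²` (`IsUnitary.tsum_fiber_tsum_enorm_sq_eq`; the class term does not depend on the
  representative or the basis: `ClosedSubrep.tsum_enorm_sq_integratedOperator_eq_of_areUnitarilyEquivalent`) — Gelbart's (10.14),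
  Rogawski's `Σ_{π′} m(π′) tr π′(f′ ⋆ f′^*)` for the anisotropic inner form;
* `UnitaryGroup.…` — the same for `U(H)`, `H ∈ M_N(L)` ANISOTROPIC over a CM field, and its named functional
  `UnitaryGroup.diagTrace L N H μ ν hanis` (members `W ∈ S` are the data of `DiscreteAutomorphicRep (cmDatum L N H) μ`, the
  multiplicities are `ContRepresentation.multiplicity`, finite).

All statements are quantified over ALL orthogonal decompositions (no chosen one is named). The quotient-form Borel structure etc. are
inside `diagTrace` (inlined there); nothing here mentions them.

## References

* S. Gelbart, *Automorphic forms on adele groups*, Ann. of Math. Studies 83 (1975), Lemma 10.6, (10.12)–(10.14) [Gelbart1975].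
* I. M. Gelfand, M. I. Graev, I. I. Piatetski-Shapiro, *Representation theory and automorphic functions* (1969), Ch. 1 §2
  [GelfandGraevPiatetskiShapiro1969].
* A. Deitmar, S. Echterhoff, *Principles of Harmonic Analysis*, 2nd ed. (2014), Thm. 9.2.2 [DeitmarEchterhoff2014].
* J. Rogawski, *Automorphic Representations of Unitary Groups in Three Variables* (1990), §14.4–14.5 (print p. 237) [Rogawski1990].
-/

noncomputable section

open MeasureTheory Measure Set Filter Topology CompactlySupported NumberField
open Literature.MeasureTheory.Group Literature.Analysis.OperatorTheory
open ContRepresentation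
open scoped ENNReal NNReal InnerProductSpace

namespace Literature.NumberTheory.Automorphic

namespace AdelicGroupData

universe u

/-! ### `L²` of a compact automorphic quotient: an orthogonal decomposition into irreducibles -/

section Decomposition

variable {K : Type} [Field K] [NumberField K] (𝒢 : AdelicGroupData.{u} K)
  (μ : Measure 𝒢.automorphicQuotient) [𝒢.IsAutomorphicMeasure μ]
  [LocallyCompactSpace 𝒢.Adelic] [SecondCountableTopology 𝒢.Adelic]

/-- **`L²(G(𝔸_K) ⧸ A_G G(K), μ)` of a COMPACT automorphic quotient is a Hilbert direct sum of countably many irreducible closed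
invariant subspaces, each class with finite multiplicity** (Gelfand–Graev–Piatetski-Shapiro; Deitmar–Echterhoff Thm. 9.2.2): there is
a countable set `S` of topologically irreducible, pairwise orthogonal closed subrepresentations of the regular representation whose
sum is dense, and `multiplicity W < ∞` for every `W ∈ S` (the multiplicity being `#{W′ ∈ S | W′ ≃ W}`,
`IsUnitary.multiplicity_eq_card_of_set`). [cite: DeitmarEchterhoff2014, Thm. 9.2.2] -/
theorem exists_orthogonalDecomposition_rightRegular [CompactSpace 𝒢.automorphicQuotient] :
    ∃ S : Set (ClosedSubrep (𝒢.rightRegular μ)),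
      (∀ W ∈ S, W.toContRep.IsTopIrreducible) ∧
      S.Pairwise (fun W W' => W.toSubmodule ⟂ W'.toSubmodule) ∧
      ClosedSubrep.iSupClosure S = ⊤ ∧ S.Countable ∧
      ∀ W ∈ S, (𝒢.rightRegular μ).multiplicity W.toContRep < ⊤ := by
  have hu := 𝒢.isUnitary_rightRegular μ
  obtain ⟨S, hirr, horth, hdense⟩ := hu.exists_orthogonalDecomposition_of_isDiscretelyDecomposable
    (𝒢.isDiscretelyDecomposable_rightRegular_of_locallyCompactSpace μ)
  haveI : SecondCountableTopology (𝒢.L2 μ) := 𝒢.secondCountableTopology_L2 μ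
  exact ⟨S, hirr, horth, hdense,
    horth.countable_of_isOrtho fun W hW => ClosedSubrep.ne_bot_of_isTopIrreducible (hirr W hW),
    fun W hW => 𝒢.multiplicity_lt_top_of_compactSpace μ W (ClosedSubrep.ne_bot_of_isTopIrreducible (hirr W hW))⟩

end Decomposition

/-! ### The diagonal trace over an orthogonal decomposition -/

section Expansion

variable {K : Type} [Field K] [NumberField K] (𝒢 : AdelicGroupData.{u} K)
  (μ : Measure 𝒢.automorphicQuotient) [𝒢.IsAutomorphicMeasure μ]
  [LocallyCompactSpace 𝒢.Adelic] [SecondCountableTopology 𝒢.Adelic] [T2Space 𝒢.Adelic]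
  [MeasurableSpace 𝒢.Adelic] [BorelSpace 𝒢.Adelic]
  [hH : IsClosed (𝒢.quotientSubgroup : Set 𝒢.Adelic)]
  (ρ : Measure 𝒢.quotientSubgroup) [ρ.IsMulLeftInvariant] [ρ.IsMulRightInvariant] [ρ.IsInvInvariant]
  [IsFiniteMeasureOnCompacts ρ] [SFinite ρ]
  (ν : Measure 𝒢.Adelic) [IsHaarMeasure ν] [ν.IsInvInvariant]

/-- **`θ(F) = Σ_i ‖R(f) e_i‖ₑ²` in `[0, ∞]`** for `F = f ⋆ f^*` and a countable Hilbert basis of `L²(X, μ)`: the real identity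
`diagTrace_hasSum_norm_sq` recast with extended non-negative norms (the currency of the tree's Hilbert–Schmidt block lemmas).
[cite: Gelbart1975, (9.11) and Lemma 10.6] -/
theorem ofReal_diagTrace_re_eq_tsum_enorm_sq [CompactSpace 𝒢.automorphicQuotient] (hρ : ρ ≠ 0)
    (f F : C_c(𝒢.Adelic, ℂ)) (hF : ∀ x, F x = mulConv ν (⇑f) (mulStar (⇑f)) x)
    {ι : Type*} [Countable ι] (B : HilbertBasis ι ℂ (𝒢.L2 μ)) :
    ENNReal.ofReal (𝒢.diagTrace μ ρ ν F).re =
      ∑' i, ‖(𝒢.rightRegular μ).integratedOperator (𝒢.isUnitary_rightRegular μ)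
        (𝒢.isStronglyContinuous_rightRegular_holds μ) ν f (B i)‖ₑ ^ 2 := by
  have h := 𝒢.diagTrace_hasSum_norm_sq μ ρ ν hρ f F hF B
  rw [← h.tsum_eq, ENNReal.ofReal_tsum_of_nonneg (fun i => sq_nonneg _) h.summable]
  refine tsum_congr fun i => ?_
  rw [ENNReal.ofReal_pow (norm_nonneg _), ofReal_norm]

/-- **Block expansion `θ(f ⋆ f^*) = Σ_{W ∈ S} ‖R(f)|_W‖²_{HS}`** (Gelbart (10.12)–(10.13)): for EVERY set `S` of pairwise orthogonal closed
subrepresentations of `L²(X, μ)` with dense sum and every family of Hilbert bases `(e^W_k)_k` of its members,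
`θ(F) = Σ_{W ∈ S} Σ_k ‖R(f) e^W_k‖²` in `[0, ∞]` (`F = f ⋆ f^*`; `ClosedSubrep.tsum_enorm_sq_apply_eq_tsum_set` on a countable Hilbert
basis of `L²`, `exists_countable_hilbertBasis_L2`). [cite: Gelbart1975, (10.12)–(10.14)] -/
theorem ofReal_diagTrace_re_eq_tsum_blocks [CompactSpace 𝒢.automorphicQuotient] (hρ : ρ ≠ 0)
    (f F : C_c(𝒢.Adelic, ℂ)) (hF : ∀ x, F x = mulConv ν (⇑f) (mulStar (⇑f)) x)
    {S : Set (ClosedSubrep (𝒢.rightRegular μ))} (horth : S.Pairwise fun W W' => W.toSubmodule ⟂ W'.toSubmodule)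
    (hdense : ClosedSubrep.iSupClosure S = ⊤)
    {κ : S → Type*} (b : ∀ W : S, HilbertBasis (κ W) ℂ (W : ClosedSubrep (𝒢.rightRegular μ)).toSubmodule) :
    ENNReal.ofReal (𝒢.diagTrace μ ρ ν F).re =
      ∑' W : S, ∑' k, ‖(𝒢.rightRegular μ).integratedOperator (𝒢.isUnitary_rightRegular μ)
        (𝒢.isStronglyContinuous_rightRegular_holds μ) ν f (b W k : 𝒢.L2 μ)‖ₑ ^ 2 := by
  obtain ⟨w, B, hw, -⟩ := 𝒢.exists_countable_hilbertBasis_L2 μ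
  haveI : Countable w := hw
  rw [𝒢.ofReal_diagTrace_re_eq_tsum_enorm_sq μ ρ ν hρ f F hF B]
  exact ClosedSubrep.tsum_enorm_sq_apply_eq_tsum_set horth hdense b B _

/-- Each block is bounded by the whole: `Σ_k ‖R(f) e^W_k‖² ≤ θ(f ⋆ f^*)` (in particular every block is finite).
[cite: Gelbart1975, (10.12)–(10.14)] -/
theorem tsum_block_le_ofReal_diagTrace_re [CompactSpace 𝒢.automorphicQuotient] (hρ : ρ ≠ 0)
    (f F : C_c(𝒢.Adelic, ℂ)) (hF : ∀ x, F x = mulConv ν (⇑f) (mulStar (⇑f)) x)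
    {S : Set (ClosedSubrep (𝒢.rightRegular μ))} (horth : S.Pairwise fun W W' => W.toSubmodule ⟂ W'.toSubmodule)
    (hdense : ClosedSubrep.iSupClosure S = ⊤)
    {κ : S → Type*} (b : ∀ W : S, HilbertBasis (κ W) ℂ (W : ClosedSubrep (𝒢.rightRegular μ)).toSubmodule) (W : S) :
    ∑' k, ‖(𝒢.rightRegular μ).integratedOperator (𝒢.isUnitary_rightRegular μ)
        (𝒢.isStronglyContinuous_rightRegular_holds μ) ν f (b W k : 𝒢.L2 μ)‖ₑ ^ 2 ≤
      ENNReal.ofReal (𝒢.diagTrace μ ρ ν F).re := by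
  rw [𝒢.ofReal_diagTrace_re_eq_tsum_blocks μ ρ ν hρ f F hF horth hdense b]
  exact ENNReal.le_tsum W

/-- The real form: `Re θ(F) = (Σ_{W ∈ S} Σ_k ‖R(f) e^W_k‖ₑ²).toReal` (the left side is `≥ 0`, `diagTrace_re_nonneg`).
[cite: Gelbart1975, (10.12)–(10.14)] -/
theorem diagTrace_re_eq_toReal_tsum_blocks [CompactSpace 𝒢.automorphicQuotient] (hρ : ρ ≠ 0)
    (f F : C_c(𝒢.Adelic, ℂ)) (hF : ∀ x, F x = mulConv ν (⇑f) (mulStar (⇑f)) x)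
    {S : Set (ClosedSubrep (𝒢.rightRegular μ))} (horth : S.Pairwise fun W W' => W.toSubmodule ⟂ W'.toSubmodule)
    (hdense : ClosedSubrep.iSupClosure S = ⊤)
    {κ : S → Type*} (b : ∀ W : S, HilbertBasis (κ W) ℂ (W : ClosedSubrep (𝒢.rightRegular μ)).toSubmodule) :
    (𝒢.diagTrace μ ρ ν F).re =
      (∑' W : S, ∑' k, ‖(𝒢.rightRegular μ).integratedOperator (𝒢.isUnitary_rightRegular μ)
        (𝒢.isStronglyContinuous_rightRegular_holds μ) ν f (b W k : 𝒢.L2 μ)‖ₑ ^ 2).toReal := by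
  rw [← 𝒢.ofReal_diagTrace_re_eq_tsum_blocks μ ρ ν hρ f F hF horth hdense b,
    ENNReal.toReal_ofReal (𝒢.diagTrace_re_nonneg μ ρ ν hρ f F hF)]

/-- **The multiplicity form `θ(f ⋆ f^*) = Σ_{[π]} m(π) ‖π(f)‖²_{HS}`** (Gelbart (10.14): `tr R(f ⋆ f^*) = Σ_π m(π) tr π(f) π(f)^*`;
Rogawski §14.5: `T_{G′}(f′) = Σ_{π′} m(π′) tr π′(f′)` for the anisotropic inner form). Let `S` be an orthogonal decomposition of `L²(X, μ)`
into irreducibles with member bases `(e^W_k)`, `q : S → Λ` a map CLASSIFYING unitary equivalence (`q W = q W′ ↔ W ≃ W′`) and `rep` a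
choice of a member in each class `c ∈ range q`. Then, for `F = f ⋆ f^*`,
`θ(F) = Σ_{c ∈ range q} multiplicity(rep c) · Σ_k ‖R(f) e^{rep c}_k‖²` in `[0, ∞]`; the class term depends neither on the representative nor
on the basis (`ClosedSubrep.tsum_enorm_sq_integratedOperator_eq_of_areUnitarilyEquivalent`), and `multiplicity(rep c) = #q⁻¹(c)`
(`IsUnitary.multiplicity_eq_card_of_set`). [cite: Gelbart1975, (10.14)] [cite: Rogawski1990, §14.5 p. 237] -/
theorem ofReal_diagTrace_re_eq_tsum_multiplicity_mul [CompactSpace 𝒢.automorphicQuotient] (hρ : ρ ≠ 0)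
    (f F : C_c(𝒢.Adelic, ℂ)) (hF : ∀ x, F x = mulConv ν (⇑f) (mulStar (⇑f)) x)
    {S : Set (ClosedSubrep (𝒢.rightRegular μ))} (hirr : ∀ W ∈ S, W.toContRep.IsTopIrreducible)
    (horth : S.Pairwise fun W W' => W.toSubmodule ⟂ W'.toSubmodule) (hdense : ClosedSubrep.iSupClosure S = ⊤)
    {κ : S → Type*} (b : ∀ W : S, HilbertBasis (κ W) ℂ (W : ClosedSubrep (𝒢.rightRegular μ)).toSubmodule)
    {Λ : Type*} (q : S → Λ)
    (hq : ∀ W W' : S, q W = q W' ↔ AreUnitarilyEquivalent (W : ClosedSubrep (𝒢.rightRegular μ)).toContRep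
      (W' : ClosedSubrep (𝒢.rightRegular μ)).toContRep)
    (rep : Set.range q → S) (hrep : ∀ c, q (rep c) = c) :
    ENNReal.ofReal (𝒢.diagTrace μ ρ ν F).re =
      ∑' c : Set.range q, ((𝒢.rightRegular μ).multiplicity (rep c : ClosedSubrep (𝒢.rightRegular μ)).toContRep : ℝ≥0∞) *
        ∑' k, ‖(𝒢.rightRegular μ).integratedOperator (𝒢.isUnitary_rightRegular μ)
          (𝒢.isStronglyContinuous_rightRegular_holds μ) ν f (b (rep c) k : 𝒢.L2 μ)‖ₑ ^ 2 := by
  have hu := 𝒢.isUnitary_rightRegular μ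
  have hc := 𝒢.isStronglyContinuous_rightRegular_holds μ
  obtain ⟨w, B, hw, -⟩ := 𝒢.exists_countable_hilbertBasis_L2 μ
  haveI : Countable w := hw
  rw [𝒢.ofReal_diagTrace_re_eq_tsum_enorm_sq μ ρ ν hρ f F hF B,
    ClosedSubrep.tsum_enorm_sq_apply_eq_tsum_fiberwise horth hdense b B _ q]
  -- the classes outside `range q` contribute nothing
  have hsupp : (Function.support fun c : Λ => ∑' W : q ⁻¹' {c}, ∑' k,
      ‖(𝒢.rightRegular μ).integratedOperator hu hc ν f (b W.1 k : 𝒢.L2 μ)‖ₑ ^ 2) ⊆ Set.range q := by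
    intro c hc0
    by_contra hc'
    apply hc0
    haveI : IsEmpty (q ⁻¹' {c}) := ⟨fun W => hc' ⟨W.1, W.2⟩⟩
    exact tsum_empty
  rw [← tsum_subtype_eq_of_support_subset hsupp]
  refine tsum_congr fun c => ?_
  -- each class `c = q (rep c)` contributes `m(rep c) · ‖R(f)|_{rep c}‖²_{HS}`
  have key : ∀ (c₀ : Λ) (W₀ : S), q W₀ = c₀ →
      ∑' W : q ⁻¹' {c₀}, ∑' k, ‖(𝒢.rightRegular μ).integratedOperator hu hc ν f (b W.1 k : 𝒢.L2 μ)‖ₑ ^ 2 =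
        ((𝒢.rightRegular μ).multiplicity (W₀ : ClosedSubrep (𝒢.rightRegular μ)).toContRep : ℝ≥0∞) *
          ∑' k, ‖(𝒢.rightRegular μ).integratedOperator hu hc ν f (b W₀ k : 𝒢.L2 μ)‖ₑ ^ 2 := by
    rintro c₀ W₀ rfl
    exact hu.tsum_fiber_tsum_enorm_sq_eq hc ν f hirr horth hdense b q hq W₀
  exact key c (rep c) (hrep c)

end Expansion

end AdelicGroupData

/-! ### The unitary group of an anisotropic hermitian matrix over a CM field -/

namespace UnitaryGroup

open Literature.AlgebraicGeometry.ShimuraVarieties (hermForm)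

variable (L : Type) [Field L] [NumberField L] [IsCMField L] (N : ℕ) (H : Matrix (Fin N) (Fin N) L)
  (μ : Measure (cmDatum L N H).automorphicQuotient) [(cmDatum L N H).IsAutomorphicMeasure μ]

/-- **`L²(U(H)(L⁺)\U(H)(𝔸_{L⁺}), μ)` decomposes**, `H` anisotropic: a countable orthogonal decomposition into irreducible closed
invariant subspaces (each a `DiscreteAutomorphicRep (cmDatum L N H) μ` datum `⟨W, _⟩`), dense, every class of finite multiplicity
(`exists_orthogonalDecomposition_rightRegular` on the compact quotient `compactSpace_cmDatum_automorphicQuotient`).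
[cite: DeitmarEchterhoff2014, Thm. 9.2.2] [cite: Rogawski1990, §14.5 p. 237] -/
theorem exists_orthogonalDecomposition_rightRegular_cmDatum
    (hanis : ∀ x : Fin N → L, hermForm (cmConjRingHom L) H x x = 0 → x = 0) :
    ∃ S : Set (ClosedSubrep ((cmDatum L N H).rightRegular μ)),
      (∀ W ∈ S, W.toContRep.IsTopIrreducible) ∧
      S.Pairwise (fun W W' => W.toSubmodule ⟂ W'.toSubmodule) ∧
      ClosedSubrep.iSupClosure S = ⊤ ∧ S.Countable ∧
      ∀ W ∈ S, ((cmDatum L N H).rightRegular μ).multiplicity W.toContRep < ⊤ := by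
  haveI := compactSpace_cmDatum_automorphicQuotient L N H hanis
  exact (cmDatum L N H).exists_orthogonalDecomposition_rightRegular μ

variable [MeasurableSpace (cmDatum L N H).Adelic] [BorelSpace (cmDatum L N H).Adelic]
  (ν : Measure (cmDatum L N H).Adelic) [ν.IsHaarMeasure] [ν.IsInvInvariant]

/-- **Block expansion for `θ_{G′}`**, `G′ = U(H)` anisotropic: for every orthogonal decomposition `S` of `L²` with member bases,
`θ_{G′}(f′ ⋆ f′^*) = Σ_{W ∈ S} Σ_k ‖R(f′) e^W_k‖²` in `[0, ∞]` (`θ_{G′} = UnitaryGroup.diagTrace L N H μ ν hanis`).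
[cite: Rogawski1990, §14.5 p. 237] [cite: Gelbart1975, (10.12)–(10.14)] -/
theorem ofReal_diagTrace_re_eq_tsum_blocks (hanis : ∀ x : Fin N → L, hermForm (cmConjRingHom L) H x x = 0 → x = 0)
    (f F : C_c((cmDatum L N H).Adelic, ℂ)) (hF : ∀ x, F x = mulConv ν (⇑f) (mulStar (⇑f)) x)
    {S : Set (ClosedSubrep ((cmDatum L N H).rightRegular μ))}
    (horth : S.Pairwise fun W W' => W.toSubmodule ⟂ W'.toSubmodule) (hdense : ClosedSubrep.iSupClosure S = ⊤)
    {κ : S → Type*} (b : ∀ W : S, HilbertBasis (κ W) ℂ (W : ClosedSubrep ((cmDatum L N H).rightRegular μ)).toSubmodule) :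
    ENNReal.ofReal (diagTrace L N H μ ν hanis F).re =
      ∑' W : S, ∑' k, ‖((cmDatum L N H).rightRegular μ).integratedOperator ((cmDatum L N H).isUnitary_rightRegular μ)
        ((cmDatum L N H).isStronglyContinuous_rightRegular_holds μ) ν f (b W k : (cmDatum L N H).L2 μ)‖ₑ ^ 2 := by
  haveI := compactSpace_cmDatum_automorphicQuotient L N H hanis
  haveI := isClosed_cmDatum_quotientSubgroup L N H
  haveI := countable_cmDatum_quotientSubgroup L N H
  haveI := isFiniteMeasureOnCompacts_count_cmDatum_quotientSubgroup L N H
  exact AdelicGroupData.ofReal_diagTrace_re_eq_tsum_blocks (cmDatum L N H) μ Measure.count ν (NeZero.ne _) f F hF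
    horth hdense b

/-- **`θ_{G′}(f′ ⋆ f′^*) = Σ_{[π′]} m(π′) ‖π′(f′)‖²_{HS}` for the anisotropic inner form `G′ = U(H)`** (Rogawski (1990), §14.5:
"the trace of `ρ(f′)` on `L(G′)` … `Σ m(π′) tr π′(f′)`", here in Gelbart's Hilbert–Schmidt form (10.14)): for every orthogonal
decomposition `S` of `L²(U(H)(L⁺)\U(H)(𝔸_{L⁺}), μ)` into irreducibles, every classifying map `q` with representatives `rep`,
`θ_{G′}(F′) = Σ_c m(rep c) · Σ_k ‖R(f′) e^{rep c}_k‖²`, `m = ContRepresentation.multiplicity` (finite). [cite: Rogawski1990, §14.5 p. 237]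
[cite: Gelbart1975, (10.14)] -/
theorem ofReal_diagTrace_re_eq_tsum_multiplicity_mul
    (hanis : ∀ x : Fin N → L, hermForm (cmConjRingHom L) H x x = 0 → x = 0)
    (f F : C_c((cmDatum L N H).Adelic, ℂ)) (hF : ∀ x, F x = mulConv ν (⇑f) (mulStar (⇑f)) x)
    {S : Set (ClosedSubrep ((cmDatum L N H).rightRegular μ))} (hirr : ∀ W ∈ S, W.toContRep.IsTopIrreducible)
    (horth : S.Pairwise fun W W' => W.toSubmodule ⟂ W'.toSubmodule) (hdense : ClosedSubrep.iSupClosure S = ⊤)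
    {κ : S → Type*} (b : ∀ W : S, HilbertBasis (κ W) ℂ (W : ClosedSubrep ((cmDatum L N H).rightRegular μ)).toSubmodule)
    {Λ : Type*} (q : S → Λ)
    (hq : ∀ W W' : S, q W = q W' ↔ AreUnitarilyEquivalent (W : ClosedSubrep ((cmDatum L N H).rightRegular μ)).toContRep
      (W' : ClosedSubrep ((cmDatum L N H).rightRegular μ)).toContRep)
    (rep : Set.range q → S) (hrep : ∀ c, q (rep c) = c) :
    ENNReal.ofReal (diagTrace L N H μ ν hanis F).re =
      ∑' c : Set.range q,
        (((cmDatum L N H).rightRegular μ).multiplicity (rep c : ClosedSubrep ((cmDatum L N H).rightRegular μ)).toContRep : ℝ≥0∞) *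
        ∑' k, ‖((cmDatum L N H).rightRegular μ).integratedOperator ((cmDatum L N H).isUnitary_rightRegular μ)
          ((cmDatum L N H).isStronglyContinuous_rightRegular_holds μ) ν f (b (rep c) k : (cmDatum L N H).L2 μ)‖ₑ ^ 2 := by
  haveI := compactSpace_cmDatum_automorphicQuotient L N H hanis
  haveI := isClosed_cmDatum_quotientSubgroup L N H
  haveI := countable_cmDatum_quotientSubgroup L N H
  haveI := isFiniteMeasureOnCompacts_count_cmDatum_quotientSubgroup L N H
  exact AdelicGroupData.ofReal_diagTrace_re_eq_tsum_multiplicity_mul (cmDatum L N H) μ Measure.count ν (NeZero.ne _) f F hF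
    hirr horth hdense b q hq rep hrep

end UnitaryGroup

end Literature.NumberTheory.Automorphic
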